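import Literature.Computability.Learning.HypPFP
import HarnessLib

/-!
# The `AC⁰[p]` learner: level parameters, lengths and their codes

Machine-layer groundwork for the named fact `Literature.Computability.Learning.cikk_learn_AC0Mod`
(CIKK 2016, Cor. 5.4). The learner processes levels `ℓ = 0, 1, 2, …` (block length `L = 2^ℓ` of
the NW design) as far as its coins reach; this file fixes, for the size parameter
`s = size₂(n + a + b + 2)` of the PAC parameters `⟨1ⁿ, 1ᵃ, 1ᵇ⟩` (`ε ≥ 1/a`, `δ ≥ 1/b`) and the
prime `p` (`P = size₂ p`), the parameters of level `ℓ`: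

* `κP`, `kP = 2^κ` (direct-product arity), `τP`, `TP = 2^τ` (vN repetitions), `βP` (bits of a
  position block), `kkP` (GL seeds), `KKP = p^{kk}` (the enumeration pad), `tP` (DP sampling steps),
  `NP = 2T(kn + kβ)` (the amplified input length), `teP`/`QP = p^{te} ≥ N` (the design field,
  `prmTe`/`prmQ`), `θNP/θDP` (the GL threshold `μ/2/2/(4p)` as a fraction), `RepsP` (runs per
  level), `MP` (validation samples per level);
* the lengths: `lvlRunLenP` (coins of one run, `HypPFP.runLenP`), `nQRunP` (queries of one run),
  `lvlSlotP = lvlRunLenP + nQRunP`, `lvlBlockLenP = Reps · slot + M · n`, `lvlCoffP` (offset of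
  level `ℓ`), `LvlProcessedP`;
* the genuine parameter record `prmLvl n a b ℓ : PrmT` of `HypPFP`;
* all of them as polynomial-time codes in BINARY from `⟨⟨1ⁿ, ⟨1ᵃ, 1ᵇ⟩⟩, 1^ℓ⟩` (`lvl_codes`), so that
  processedness is decidable in polynomial time without any capping.

## References

* M. Carmosino, R. Impagliazzo, V. Kabanets, A. Kolokolova, *Learning algorithms from natural
  proofs*, CCC 2016, §5 (complete algorithm; parameters) [CarmosinoImpagliazzoKabanetsKolokolova2016].
-/

open Polynomial

namespace Literature.Computability.Learning

namespace Modp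

open Literature.Computability.Complexity Literature.Computability.Complexity.GaussRank
  Literature.Computability.Cryptography Literature.Computability.MetaComplexity _root_.Computability CodeFP Finset

variable [P : PrimeP]

/-! ### The design field -/

/-- `te(N) = max 1 (clog_p N)`: the least `t ≥ 1` with `N ≤ pᵗ`. [cite: CarmosinoImpagliazzoKabanetsKolokolova2016, Thm. 3.6 (proof)] -/
def prmTe (N : ℕ) : ℕ := max 1 (Nat.clog 𝔭 N)

/-- **The field size `Q(N) = p^{te(N)}`.** [cite: CarmosinoImpagliazzoKabanetsKolokolova2016, Thm. 3.6] -/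
def prmQ (N : ℕ) : ℕ := 𝔭 ^ prmTe N

/-- `te(N) ≠ 0`. [folklore] -/
theorem prmTe_ne_zero (N : ℕ) : prmTe N ≠ 0 := Nat.one_le_iff_ne_zero.1 (le_max_left _ _)

/-- `N ≤ Q(N)`. [folklore] -/
theorem le_prmQ (N : ℕ) : N ≤ prmQ N :=
  (Nat.le_pow_clog P.prime.one_lt N).trans (Nat.pow_le_pow_right P.prime.pos (le_max_right _ _))

/-- `Q(N) ≤ p (N + 1)`. [cite: CarmosinoImpagliazzoKabanetsKolokolova2016, Thm. 3.6 ("a field of size at most `pn`")] -/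
theorem prmQ_le (N : ℕ) : prmQ N ≤ 𝔭 * (N + 1) := by
  have h1 := P.prime.one_lt
  rw [prmQ, prmTe]
  rcases le_or_gt N 1 with hn | hn
  · rw [Nat.clog_of_right_le_one hn, max_eq_left (Nat.zero_le 1), pow_one]
    exact Nat.le_mul_of_pos_right _ (Nat.succ_pos _)
  · have hc : 0 < Nat.clog 𝔭 N := Nat.clog_pos h1 hn
    rw [max_eq_right hc]
    have hlt := Nat.pow_pred_clog_lt_self h1 hn
    calc 𝔭 ^ Nat.clog 𝔭 N = 𝔭 * 𝔭 ^ (Nat.clog 𝔭 N).pred := by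
          rw [← pow_succ']; congr 1; exact (Nat.succ_pred_eq_of_pos hc).symm
      _ ≤ 𝔭 * (N + 1) := Nat.mul_le_mul_left _ (by omega)

/-- `clog_p N` counts the `i < N` with `pⁱ < N`. [folklore] -/
theorem clog_eq_length_filter (N : ℕ) : Nat.clog 𝔭 N = ((List.range N).filter fun i => decide (𝔭 ^ i < N)).length := by
  have h1 := P.prime.one_lt
  set c := Nat.clog 𝔭 N with hc
  have hcn : c ≤ N := by
    rcases Nat.eq_zero_or_pos N with rfl | hpos
    · rw [hc, Nat.clog_zero_right]
    · exact (Nat.clog_mono_right 𝔭 (Nat.lt_two_pow_self).le).trans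
        ((Nat.clog_anti_left Nat.one_lt_two (Nat.succ_le_of_lt h1)).trans (by rw [Nat.clog_pow _ _ Nat.one_lt_two]))
  have hfilter : (List.range N).filter (fun i => decide (𝔭 ^ i < N)) = List.range c := by
    rw [show N = c + (N - c) by omega, List.range_add, List.filter_append, show c + (N - c) = N by omega]
    have hA : (List.range c).filter (fun i => decide (𝔭 ^ i < N)) = List.range c :=
      List.filter_eq_self.2 fun i hi => by rw [decide_eq_true_eq]; exact (Nat.lt_clog_iff_pow_lt h1).1 (List.mem_range.1 hi)
    have hB : ((List.range (N - c)).map (c + ·)).filter (fun i => decide (𝔭 ^ i < N)) = [] :=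
      List.filter_eq_nil_iff.2 fun i hi => by
        obtain ⟨j, -, rfl⟩ := List.mem_map.1 hi
        rw [decide_eq_true_eq, not_lt]
        exact (Nat.le_pow_clog h1 N).trans (Nat.pow_le_pow_right P.prime.pos (by omega))
    rw [hA, hB, List.append_nil]
  rw [hfilter, List.length_range]

/-- **`te` is a code** on unary numerals. [folklore] -/
theorem prmTe_code : CodeFP unE unE prmTe := by
  have hn : CodeFP (pairE unE natE) unE (fun y => y.1) := fst _ _
  have hi : CodeFP (pairE unE natE) unE (fun y => min y.2 y.1) := (unOfNatMin.comp ((fst _ _).pair (snd _ _))).congr fun _ => rfl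
  have hb : CodeFP (pairE unE natE) bitE (fun y => decide (𝔭 ^ min y.2 y.1 < y.1)) :=
    (natLt.comp ((natPow.comp ((const _ 𝔭).pair hi)).pair (natOfUn.comp hn))).congr fun _ => rfl
  have hc : CodeFP unE unE (fun N => ((List.range N).filter fun i => decide (𝔭 ^ min i N < N)).length) :=
    ((ulength natE).comp ((filter hb).comp ((CodeFP.id unE).pair urange))).congr fun _ => rfl
  have h1 : CodeFP unE unE (fun N => max 1 ((List.range N).filter fun i => decide (𝔭 ^ min i N < N)).length) := by
    refine ((natLeUn.comp ((const _ 1).pair hc)).ite hc (const _ 1)).congr fun N => ?_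
    by_cases h : 1 ≤ ((List.range N).filter fun i => decide (𝔭 ^ min i N < N)).length
    · simp [h]
    · simp [h]; omega
  refine h1.congr fun N => ?_
  rw [prmTe, clog_eq_length_filter]
  congr 2
  exact List.filter_congr fun i hi => by
    rw [List.mem_range] at hi
    simp only [min_eq_left hi.le]

/-! ### The level parameters -/

section Params

variable (n a b ℓ : ℕ)

/-- `s = size₂(n + a + b + 2)`. [folklore] -/
def sP : ℕ := Nat.size (n + a + b + 2)

/-- `P = size₂ p`. [folklore] -/
def PP : ℕ := Nat.size 𝔭

/-- `κ = 3s + size₂ ℓ + 4P + 40`. [cite: CarmosinoImpagliazzoKabanetsKolokolova2016, §5 (parameters)] -/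
def κP : ℕ := 3 * sP n a b + Nat.size ℓ + 4 * PP + 40

/-- `k = 2^κ`, the direct-product arity. [cite: CarmosinoImpagliazzoKabanetsKolokolova2016, §5] -/
def kP : ℕ := 2 ^ κP n a b ℓ

/-- `τ = size₂ ℓ + P + 4`. [cite: CarmosinoImpagliazzoKabanetsKolokolova2016, Thm. 4.7 (choice of `t`)] -/
def τP : ℕ := Nat.size ℓ + PP + 4

/-- `T = 2^τ`, the number of vN pairs. [cite: CarmosinoImpagliazzoKabanetsKolokolova2016, Thm. 4.7] -/
def TP : ℕ := 2 ^ τP ℓ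

/-- `kk`, the number of GL seeds. [cite: CarmosinoImpagliazzoKabanetsKolokolova2016, Claim 4.4 (pairwise-independent sample space)] -/
def kkP : ℕ := κP n a b ℓ + 2 * ℓ + 2 * τP ℓ + 5 * PP + 30

/-- `β`, the number of bits of a position block (large enough that all `β`-blocks of a run are valid
with probability `≥ 1/2`: `2^β ≥ 2p · #blocks`, and that `ν = 2Tkp/2^β` is negligible). [folklore] -/
def βP : ℕ := 2 * κP n a b ℓ + 3 * ℓ + 3 * τP ℓ + 5 * PP + sP n a b + kkP n a b ℓ * PP + kkP n a b ℓ + 70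

/-- `KK = p^{kk}`, the enumeration pad. [folklore] -/
def KKP : ℕ := 𝔭 ^ kkP n a b ℓ

/-- `t`, the number of DP sampling steps. [cite: ImpagliazzoEtAl2010, Thm. 1.7] -/
def tP : ℕ := 2 ^ (κP n a b ℓ + 3 * ℓ + 2 * τP ℓ + 4 * PP + sP n a b + 60) * KKP n a b ℓ

/-- `N = 2T(kn + kβ)`, the amplified input length. [folklore] -/
def NP : ℕ := TP ℓ * 2 * (kP n a b ℓ * n + kP n a b ℓ * βP n a b ℓ)

/-- `te`, the field exponent. [folklore] -/
def teP : ℕ := prmTe (NP n a b ℓ)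

/-- `Q = p^{te} ≥ N`, the design field size. [cite: CarmosinoImpagliazzoKabanetsKolokolova2016, Thm. 3.6] -/
def QP : ℕ := 𝔭 ^ teP n a b ℓ

/-- The numerator of the GL threshold: `2^β · 2p^T − 2 · (2Tkp) · 10L · 2p^T − 10L · 2^β`
(the numerator of `1/(10L) − 2ν − 1/(2p^T)` over `10L · 2^β · 2p^T`). [folklore] -/
def θNP : ℕ :=
  2 ^ βP n a b ℓ * (2 * 𝔭 ^ TP ℓ) - 2 * (TP ℓ * 2 * kP n a b ℓ * 𝔭) * (10 * 2 ^ ℓ) * (2 * 𝔭 ^ TP ℓ) - 10 * 2 ^ ℓ * 2 ^ βP n a b ℓ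

/-- The denominator of the GL threshold: `10L · 2^β · 2p^T · (p · 2T) · 16p`. [folklore] -/
def θDP : ℕ := 10 * 2 ^ ℓ * 2 ^ βP n a b ℓ * (2 * 𝔭 ^ TP ℓ) * (𝔭 * (TP ℓ * 2)) * (16 * 𝔭)

/-- The exponent of the number of runs per level. [folklore] -/
def repsExpP : ℕ := 4 * ℓ + 3 * τP ℓ + 8 * PP + 2 * kkP n a b ℓ * PP + sP n a b + 80

/-- `Reps`, the number of runs per level. [cite: CarmosinoImpagliazzoKabanetsKolokolova2016, §5 (repetition)] -/
def RepsP : ℕ := 2 ^ repsExpP n a b ℓ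

/-- `M`, the validation sample size per level. [folklore] -/
def MP : ℕ := 64 * 4 ^ sP n a b * (repsExpP n a b ℓ + 2 * sP n a b + 8)

/-- **The coins of one run.** [folklore] -/
def lvlRunLenP : ℕ :=
  runLenP n (kP n a b ℓ) (βP n a b ℓ) (TP ℓ) ℓ (QP n a b ℓ) (2 ^ ℓ) (kkP n a b ℓ) (tP n a b ℓ) (κP n a b ℓ) (τP ℓ)

/-- **The membership queries of one run**: `L²` table entries of `2Tk` points, the `2Tk` filler
points, the `k` DP points. [folklore] -/
def nQRunP : ℕ := 2 ^ ℓ * 2 ^ ℓ * (TP ℓ * 2 * kP n a b ℓ) + TP ℓ * 2 * kP n a b ℓ + kP n a b ℓ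

/-- The slot of one run: its coins plus one padding bit per query. [folklore] -/
def lvlSlotP : ℕ := lvlRunLenP n a b ℓ + nQRunP n a b ℓ

/-- **The coins of level `ℓ`**: `Reps` slots and `M` validation points. [folklore] -/
def lvlBlockLenP : ℕ := RepsP n a b ℓ * lvlSlotP n a b ℓ + MP n a b ℓ * n

/-- The offset of level `ℓ`. [folklore] -/
def lvlCoffP : ℕ := ∑ ℓ' ∈ Finset.range ℓ, lvlBlockLenP n a b ℓ'

/-- Level `ℓ` is processed by coins of length `R`. [folklore] -/
def LvlProcessedP (R ℓ : ℕ) : Prop := lvlCoffP n a b (ℓ + 1) ≤ R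

/-- Processedness is decidable. [folklore] -/
instance (R ℓ : ℕ) : Decidable (LvlProcessedP n a b R ℓ) := inferInstanceAs (Decidable (_ ≤ _))

/-- **The parameter record of level `ℓ`** (`HypPFP.prmOf`). [folklore] -/
def prmLvl : PrmT :=
  prmOf (teP n a b ℓ) ℓ n (κP n a b ℓ) (βP n a b ℓ) (τP ℓ) (kkP n a b ℓ) (tP n a b ℓ) (θNP n a b ℓ) (θDP n a b ℓ)

end Params

/-! ### The run length in binary -/

section RunLenNat

omit P in
/-- **`runLenP` in binary** from `⟨n, ⟨k, ⟨β, ⟨T, ⟨ℓ, ⟨Q, ⟨L, ⟨kk, ⟨t, ⟨κ, τ⟩⟩⟩⟩⟩⟩⟩⟩⟩⟩` (all binary). [folklore] -/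
theorem runLenP_natCode : CodeFP (pairE natE (pairE natE (pairE natE (pairE natE (pairE natE (pairE natE (pairE natE (pairE natE (pairE natE
    (pairE natE natE)))))))))) natE
    (fun x => runLenP x.1 x.2.1 x.2.2.1 x.2.2.2.1 x.2.2.2.2.1 x.2.2.2.2.2.1 x.2.2.2.2.2.2.1 x.2.2.2.2.2.2.2.1 x.2.2.2.2.2.2.2.2.1
      x.2.2.2.2.2.2.2.2.2.1 x.2.2.2.2.2.2.2.2.2.2) := by
  let E := pairE natE (pairE natE (pairE natE (pairE natE (pairE natE (pairE natE (pairE natE (pairE natE (pairE natE (pairE natE natE)))))))))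
  have hn : CodeFP E natE (fun x => x.1) := fst _ _
  have hk : CodeFP E natE (fun x => x.2.1) := (snd _ _).fst'
  have hβ : CodeFP E natE (fun x => x.2.2.1) := (snd _ _).snd'.fst'
  have hT : CodeFP E natE (fun x => x.2.2.2.1) := (snd _ _).snd'.snd'.fst'
  have hℓ : CodeFP E natE (fun x => x.2.2.2.2.1) := (snd _ _).snd'.snd'.snd'.fst'
  have hQ : CodeFP E natE (fun x => x.2.2.2.2.2.1) := (snd _ _).snd'.snd'.snd'.snd'.fst'
  have hL : CodeFP E natE (fun x => x.2.2.2.2.2.2.1) := (snd _ _).snd'.snd'.snd'.snd'.snd'.fst'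
  have hkk : CodeFP E natE (fun x => x.2.2.2.2.2.2.2.1) := (snd _ _).snd'.snd'.snd'.snd'.snd'.snd'.fst'
  have ht : CodeFP E natE (fun x => x.2.2.2.2.2.2.2.2.1) := (snd _ _).snd'.snd'.snd'.snd'.snd'.snd'.snd'.fst'
  have hκ : CodeFP E natE (fun x => x.2.2.2.2.2.2.2.2.2.1) := (snd _ _).snd'.snd'.snd'.snd'.snd'.snd'.snd'.snd'.fst'
  have hτ : CodeFP E natE (fun x => x.2.2.2.2.2.2.2.2.2.2) := (snd _ _).snd'.snd'.snd'.snd'.snd'.snd'.snd'.snd'.snd'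
  -- `ℓ + Q² + L + (τ+1) + 2T(kn+kβ) + 2Tβ + 2β + kk k β + kk β + k + k(n+β) + t (κ + k(n+β)) + β`
  have hnβ : CodeFP E natE (fun x => x.1 + x.2.2.1) := (natAdd.comp (hn.pair hβ)).congr fun _ => rfl
  have hT2 : CodeFP E natE (fun x => x.2.2.2.1 * 2) := (natMul.comp (hT.pair (const _ 2))).congr fun _ => rfl
  refine (natAdd.comp ((natAdd.comp ((natAdd.comp ((natAdd.comp ((natAdd.comp ((natAdd.comp ((natAdd.comp ((natAdd.comp ((natAdd.comp ((natAdd.comp ((natAdd.comp ((natAdd.comp ((hℓ).pair (natMul.comp (hQ.pair hQ)))).pair (hL))).pair (natAdd.comp (hτ.pair (const _ 1))))).pair (natMul.comp (hT2.pair (natAdd.comp ((natMul.comp (hk.pair hn)).pair (natMul.comp (hk.pair hβ)))))))).pair (natMul.comp (hT2.pair hβ)))).pair (natMul.comp ((const _ 2).pair hβ)))).pair (natMul.comp ((natMul.comp (hkk.pair hk)).pair hβ)))).pair (natMul.comp (hkk.pair hβ)))).pair (hk))).pair (natMul.comp (hk.pair hnβ)))).pair (natMul.comp (ht.pair (natAdd.comp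 (hκ.pair (natMul.comp (hk.pair hnβ)))))))).pair (hβ))).congr fun x => ?_
  simp only [runLenP, offJunk, offSteps, offTup, offPbP, offGuess, offSeeds, offU, offLab, offFil, offM, offWP, offZ, stepLenP]

end RunLenNat

/-! ### Elementary facts -/

section Facts

variable (n a b ℓ : ℕ)

/-- `te ≠ 0`. [folklore] -/
theorem teP_ne_zero : teP n a b ℓ ≠ 0 := prmTe_ne_zero _

/-- `N ≤ Q`. [folklore] -/
theorem NP_le_QP : NP n a b ℓ ≤ QP n a b ℓ := le_prmQ _

/-- The design hypothesis of the level. [folklore] -/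
theorem lvl_hn : TP ℓ * 2 * (kP n a b ℓ * n + kP n a b ℓ * βP n a b ℓ) ≤ 𝔭 ^ teP n a b ℓ := NP_le_QP n a b ℓ

/-- `0 < k`. [folklore] -/
theorem kP_pos : 0 < kP n a b ℓ := by unfold kP; positivity

/-- `0 < T`. [folklore] -/
theorem TP_pos : 0 < TP ℓ := by unfold TP; positivity

/-- `p ≤ 2^β`. [folklore] -/
theorem p_le_two_pow_βP : 𝔭 ≤ 2 ^ βP n a b ℓ := by
  have h : 𝔭 < 2 ^ PP := Nat.lt_size_self _
  exact h.le.trans (Nat.pow_le_pow_right (by norm_num) (by unfold βP; omega))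

/-- `0 < B = 2^β / p`. [folklore] -/
theorem jB_pos_lvl : 0 < jB 𝔭 (βP n a b ℓ) := jB_pos (p_le_two_pow_βP n a b ℓ)

/-- `0 < θD`. [folklore] -/
theorem θDP_pos : 0 < θDP n a b ℓ := by
  have := P.prime.pos
  unfold θDP TP; positivity

/-- Processedness is downward closed. [folklore] -/
theorem lvlProcessedP_mono {R ℓ ℓ' : ℕ} (h : LvlProcessedP n a b R ℓ) (hle : ℓ' ≤ ℓ) : LvlProcessedP n a b R ℓ' :=
  le_trans (Finset.sum_le_sum_of_subset (Finset.range_mono (by omega))) h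

/-- The offsets are monotone. [folklore] -/
theorem lvlCoffP_mono {ℓ ℓ' : ℕ} (h : ℓ ≤ ℓ') : lvlCoffP n a b ℓ ≤ lvlCoffP n a b ℓ' :=
  Finset.sum_le_sum_of_subset (Finset.range_mono h)

/-- A block is at least one bit long. [folklore] -/
theorem one_le_lvlBlockLenP : 1 ≤ lvlBlockLenP n a b ℓ := by
  have h1 : 1 ≤ RepsP n a b ℓ := Nat.one_le_two_pow
  have h2 : 1 ≤ lvlSlotP n a b ℓ := by
    have := kP_pos n a b ℓ
    unfold lvlSlotP nQRunP; omega
  unfold lvlBlockLenP; nlinarith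

/-- A processed level is below the coin length. [folklore] -/
theorem lt_of_processed {R ℓ : ℕ} (h : LvlProcessedP n a b R ℓ) : ℓ < R := by
  have : ∀ m, m ≤ lvlCoffP n a b m := by
    intro m
    induction m with
    | zero => simp [lvlCoffP]
    | succ m ih =>
      have h1 := one_le_lvlBlockLenP n a b m
      have h2 : lvlCoffP n a b (m + 1) = lvlCoffP n a b m + lvlBlockLenP n a b m := by rw [lvlCoffP, Finset.sum_range_succ]; rfl
      omega
  exact Nat.lt_of_lt_of_le (Nat.lt_of_lt_of_le (Nat.lt_succ_self ℓ) (this (ℓ + 1))) h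

/-- The run `ρ` of a processed level fits into the coins. [folklore] -/
theorem slot_fits {R ℓ : ℕ} (h : LvlProcessedP n a b R ℓ) {ρ : ℕ} (hρ : ρ < RepsP n a b ℓ) :
    lvlCoffP n a b ℓ + ρ * lvlSlotP n a b ℓ + lvlSlotP n a b ℓ ≤ R := by
  have hb : lvlCoffP n a b ℓ + lvlBlockLenP n a b ℓ ≤ R := by
    have := h; unfold LvlProcessedP lvlCoffP at this; rwa [Finset.sum_range_succ] at this
  have : (ρ + 1) * lvlSlotP n a b ℓ ≤ RepsP n a b ℓ * lvlSlotP n a b ℓ := Nat.mul_le_mul_right _ hρ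
  unfold lvlBlockLenP at hb
  nlinarith

/-- The validation point `w` of a processed level fits into the coins. [folklore] -/
theorem valPt_fits {R ℓ : ℕ} (h : LvlProcessedP n a b R ℓ) {w : ℕ} (hw : w < MP n a b ℓ) :
    lvlCoffP n a b ℓ + RepsP n a b ℓ * lvlSlotP n a b ℓ + w * n + n ≤ R := by
  have hb : lvlCoffP n a b ℓ + lvlBlockLenP n a b ℓ ≤ R := by
    have := h; unfold LvlProcessedP lvlCoffP at this; rwa [Finset.sum_range_succ] at this
  have : (w + 1) * n ≤ MP n a b ℓ * n := Nat.mul_le_mul_right _ hw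
  unfold lvlBlockLenP at hb
  nlinarith

end Facts

/-! ### The parameters as polynomial-time codes -/

section Codes

/-- The typed level argument `⟨⟨1ⁿ, ⟨1ᵃ, 1ᵇ⟩⟩, 1^ℓ⟩`. [folklore] -/
abbrev LvlArgT : Type := (ℕ × (ℕ × ℕ)) × ℕ

/-- Its code. [folklore] -/
abbrev lvlArgE : LvlArgT → List Bool := pairE (pairE unE (pairE unE unE)) unE

omit P in
/-- `2^{size x} ≤ 2x + 2`. [folklore] -/
theorem two_pow_size_le (x : ℕ) : 2 ^ Nat.size x ≤ 2 * x + 2 := by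
  rcases Nat.eq_zero_or_pos x with rfl | hx
  · simp
  · have h : 2 ^ (Nat.size x - 1) ≤ x := Nat.lt_size.1 (by have := Nat.size_pos.2 hx; omega)
    have : 2 ^ Nat.size x = 2 * 2 ^ (Nat.size x - 1) := by
      rw [← pow_succ']; congr 1; have := Nat.size_pos.2 hx; omega
    omega

/-- The unary bound of `k`: `k ≤ 2^{4P+40} (2(n+a+b+2)+2)^3 (2ℓ+2)`. [folklore] -/
theorem kP_le_bound (n a b ℓ : ℕ) : kP n a b ℓ ≤ 2 ^ (4 * PP + 40) * (2 * (n + a + b + 2) + 2) ^ 3 * (2 * ℓ + 2) := by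
  have h1 := two_pow_size_le (n + a + b + 2)
  have h2 := two_pow_size_le ℓ
  have : kP n a b ℓ = 2 ^ (4 * PP + 40) * (2 ^ Nat.size (n + a + b + 2)) ^ 3 * 2 ^ Nat.size ℓ := by
    rw [kP, κP, sP, ← pow_mul, ← pow_add, ← pow_add]; congr 1; ring
  rw [this]
  gcongr

/-- The unary bound of `T`: `T ≤ 2^{P+4} (2ℓ+2)`. [folklore] -/
theorem TP_le_bound (ℓ : ℕ) : TP ℓ ≤ 2 ^ (PP + 4) * (2 * ℓ + 2) := by
  have h2 := two_pow_size_le ℓ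
  have : TP ℓ = 2 ^ (PP + 4) * 2 ^ Nat.size ℓ := by rw [TP, τP, ← pow_add]; congr 1; ring
  rw [this]
  gcongr

omit P in
/-- `size₂` is a code (unary output). [folklore] -/
theorem size_code : CodeFP natE unE Nat.size :=
  (strLength.comp strOfNat).congr fun m => by
    show (natE m).length = Nat.size m
    exact TM2Pass.length_encodeNat_eq_size m

namespace LvlArg
/-! Field and parameter codes on the typed level argument `x = ⟨⟨1ⁿ, ⟨1ᵃ, 1ᵇ⟩⟩, 1^ℓ⟩`. -/

omit P in
/-- `n`. [folklore] -/ theorem n_code : CodeFP lvlArgE unE (fun x : LvlArgT => x.1.1) := (fst _ _).fst'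
omit P in
/-- `a`. [folklore] -/ theorem a_code : CodeFP lvlArgE unE (fun x : LvlArgT => x.1.2.1) := (fst _ _).snd'.fst'
omit P in
/-- `b`. [folklore] -/ theorem b_code : CodeFP lvlArgE unE (fun x : LvlArgT => x.1.2.2) := (fst _ _).snd'.snd'
omit P in
/-- `ℓ`. [folklore] -/ theorem ℓ_code : CodeFP lvlArgE unE (fun x : LvlArgT => x.2) := snd _ _
omit P in
/-- `n + a + b + 2`. [folklore] -/
theorem sum_code : CodeFP lvlArgE unE (fun x : LvlArgT => x.1.1 + x.1.2.1 + x.1.2.2 + 2) :=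
  (unAdd.comp ((unAdd.comp ((unAdd.comp (n_code.pair a_code)).pair b_code)).pair (const _ 2))).congr fun _ => rfl
omit P in
/-- `s`. [folklore] -/
theorem s_code : CodeFP lvlArgE unE (fun x : LvlArgT => sP x.1.1 x.1.2.1 x.1.2.2) := (size_code.comp (natOfUn.comp sum_code)).congr fun _ => rfl
omit P in
/-- `size ℓ`. [folklore] -/
theorem szℓ_code : CodeFP lvlArgE unE (fun x : LvlArgT => Nat.size x.2) := (size_code.comp (natOfUn.comp ℓ_code)).congr fun _ => rfl
/-- `κ`. [folklore] -/
theorem κ_code : CodeFP lvlArgE unE (fun x : LvlArgT => κP x.1.1 x.1.2.1 x.1.2.2 x.2) :=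
  (unAdd.comp ((unAdd.comp ((unAdd.comp ((unMul.comp ((const _ 3).pair s_code)).pair szℓ_code)).pair (const _ (4 * PP)))).pair (const _ 40))).congr
    fun _ => rfl
/-- `τ`. [folklore] -/
theorem τ_code : CodeFP lvlArgE unE (fun x : LvlArgT => τP x.2) := (unAdd.comp ((unAdd.comp (szℓ_code.pair (const _ PP))).pair (const _ 4))).congr fun _ => rfl
/-- `kk`. [folklore] -/
theorem kk_code : CodeFP lvlArgE unE (fun x : LvlArgT => kkP x.1.1 x.1.2.1 x.1.2.2 x.2) :=
  (unAdd.comp ((unAdd.comp ((unAdd.comp ((unAdd.comp (κ_code.pair (unMul.comp ((const _ 2).pair ℓ_code)))).pair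
    (unMul.comp ((const _ 2).pair τ_code)))).pair (const _ (5 * PP)))).pair (const _ 30))).congr fun _ => rfl
/-- `β`. [folklore] -/
theorem β_code : CodeFP lvlArgE unE (fun x : LvlArgT => βP x.1.1 x.1.2.1 x.1.2.2 x.2) :=
  (unAdd.comp ((unAdd.comp ((unAdd.comp ((unAdd.comp ((unAdd.comp ((unAdd.comp ((unAdd.comp ((unMul.comp ((const _ 2).pair κ_code)).pair
    (unMul.comp ((const _ 3).pair ℓ_code)))).pair (unMul.comp ((const _ 3).pair τ_code)))).pair (const _ (5 * PP)))).pair s_code)).pair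
    (unMul.comp (kk_code.pair (const _ PP))))).pair kk_code)).pair (const _ 70))).congr fun _ => rfl
/-- `k` (binary). [folklore] -/
theorem k_code : CodeFP lvlArgE natE (fun x : LvlArgT => kP x.1.1 x.1.2.1 x.1.2.2 x.2) := (natPow.comp ((const _ 2).pair κ_code)).congr fun _ => rfl
/-- `T` (binary). [folklore] -/
theorem T_code : CodeFP lvlArgE natE (fun x : LvlArgT => TP x.2) := (natPow.comp ((const _ 2).pair τ_code)).congr fun _ => rfl
/-- `KK` (binary). [folklore] -/
theorem KK_code : CodeFP lvlArgE natE (fun x : LvlArgT => KKP x.1.1 x.1.2.1 x.1.2.2 x.2) := (natPow.comp ((const _ 𝔭).pair kk_code)).congr fun _ => rfl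
/-- `t` (binary). [folklore] -/
theorem t_code : CodeFP lvlArgE natE (fun x : LvlArgT => tP x.1.1 x.1.2.1 x.1.2.2 x.2) :=
  (natMul.comp ((natPow.comp ((const _ 2).pair (unAdd.comp ((unAdd.comp ((unAdd.comp ((unAdd.comp ((unAdd.comp (κ_code.pair
    (unMul.comp ((const _ 3).pair ℓ_code)))).pair (unMul.comp ((const _ 2).pair τ_code)))).pair (const _ (4 * PP)))).pair s_code)).pair (const _ 60))))).pair
    KK_code)).congr fun _ => rfl
/-- The unary bound of `k`. [folklore] -/
theorem kBound_code : CodeFP lvlArgE unE (fun x : LvlArgT => 2 ^ (4 * PP + 40) * (2 * (x.1.1 + x.1.2.1 + x.1.2.2 + 2) + 2) ^ 3 * (2 * x.2 + 2)) := by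
  have h2 : CodeFP lvlArgE unE (fun x : LvlArgT => 2 * (x.1.1 + x.1.2.1 + x.1.2.2 + 2) + 2) :=
    (unAdd.comp ((unMul.comp ((const _ 2).pair sum_code)).pair (const _ 2))).congr fun _ => rfl
  have h3 : CodeFP lvlArgE unE (fun x : LvlArgT => (2 * (x.1.1 + x.1.2.1 + x.1.2.2 + 2) + 2) ^ 3) :=
    (unMul.comp ((unMul.comp (h2.pair h2)).pair h2)).congr fun x => by show _ * _ * _ = _ ^ 3; ring
  exact (unMul.comp ((unMul.comp ((const _ (2 ^ (4 * PP + 40))).pair h3)).pair (unAdd.comp ((unMul.comp ((const _ 2).pair ℓ_code)).pair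
    (const _ 2))))).congr fun _ => rfl
/-- `k` (unary). [folklore] -/
theorem kU_code : CodeFP lvlArgE unE (fun x : LvlArgT => kP x.1.1 x.1.2.1 x.1.2.2 x.2) :=
  (unOfNatMin.comp (kBound_code.pair k_code)).congr fun _ => min_eq_left (kP_le_bound _ _ _ _)
/-- `T` (unary). [folklore] -/
theorem TU_code : CodeFP lvlArgE unE (fun x : LvlArgT => TP x.2) :=
  (unOfNatMin.comp ((unMul.comp ((const _ (2 ^ (PP + 4))).pair (unAdd.comp ((unMul.comp ((const _ 2).pair ℓ_code)).pair (const _ 2))))).pair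
    T_code)).congr fun _ => min_eq_left (TP_le_bound _)
/-- `N` (unary). [folklore] -/
theorem NU_code : CodeFP lvlArgE unE (fun x : LvlArgT => NP x.1.1 x.1.2.1 x.1.2.2 x.2) :=
  (unMul.comp ((unMul.comp (TU_code.pair (const _ 2))).pair (unAdd.comp ((unMul.comp (kU_code.pair n_code)).pair (unMul.comp (kU_code.pair β_code)))))).congr
    fun _ => rfl
/-- `N` (binary). [folklore] -/
theorem N_code : CodeFP lvlArgE natE (fun x : LvlArgT => NP x.1.1 x.1.2.1 x.1.2.2 x.2) := (natOfUn.comp NU_code).congr fun _ => rfl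
/-- `te`. [folklore] -/
theorem te_code : CodeFP lvlArgE unE (fun x : LvlArgT => teP x.1.1 x.1.2.1 x.1.2.2 x.2) := (prmTe_code.comp NU_code).congr fun _ => rfl
/-- `Q` (binary). [folklore] -/
theorem Q_code : CodeFP lvlArgE natE (fun x : LvlArgT => QP x.1.1 x.1.2.1 x.1.2.2 x.2) := (natPow.comp ((const _ 𝔭).pair te_code)).congr fun _ => rfl
omit P in
/-- `2^ℓ` (binary). [folklore] -/
theorem L_code : CodeFP lvlArgE natE (fun x : LvlArgT => 2 ^ x.2) := (natPow.comp ((const _ 2).pair ℓ_code)).congr fun _ => rfl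
/-- `θN`. [folklore] -/
theorem θN_code : CodeFP lvlArgE natE (fun x : LvlArgT => θNP x.1.1 x.1.2.1 x.1.2.2 x.2) := by
  have h2β : CodeFP lvlArgE natE (fun x : LvlArgT => 2 ^ βP x.1.1 x.1.2.1 x.1.2.2 x.2) := (natPow.comp ((const _ 2).pair β_code)).congr fun _ => rfl
  have hpT : CodeFP lvlArgE natE (fun x : LvlArgT => 2 * 𝔭 ^ TP x.2) := (natMul.comp ((const _ 2).pair (natPow.comp ((const _ 𝔭).pair TU_code)))).congr fun _ => rfl
  have h10L : CodeFP lvlArgE natE (fun x : LvlArgT => 10 * 2 ^ x.2) := (natMul.comp ((const _ 10).pair L_code)).congr fun _ => rfl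
  have hT2k : CodeFP lvlArgE natE (fun x : LvlArgT => TP x.2 * 2 * kP x.1.1 x.1.2.1 x.1.2.2 x.2 * 𝔭) :=
    (natMul.comp ((natMul.comp ((natMul.comp (T_code.pair (const _ 2))).pair k_code)).pair (const _ 𝔭))).congr fun _ => rfl
  exact (natSub.comp ((natSub.comp ((natMul.comp (h2β.pair hpT)).pair (natMul.comp ((natMul.comp ((natMul.comp ((const _ 2).pair hT2k)).pair
    h10L)).pair hpT)))).pair (natMul.comp (h10L.pair h2β)))).congr fun _ => rfl
/-- `θD`. [folklore] -/
theorem θD_code : CodeFP lvlArgE natE (fun x : LvlArgT => θDP x.1.1 x.1.2.1 x.1.2.2 x.2) := by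
  have h2β : CodeFP lvlArgE natE (fun x : LvlArgT => 2 ^ βP x.1.1 x.1.2.1 x.1.2.2 x.2) := (natPow.comp ((const _ 2).pair β_code)).congr fun _ => rfl
  have hpT : CodeFP lvlArgE natE (fun x : LvlArgT => 2 * 𝔭 ^ TP x.2) := (natMul.comp ((const _ 2).pair (natPow.comp ((const _ 𝔭).pair TU_code)))).congr fun _ => rfl
  have h10L : CodeFP lvlArgE natE (fun x : LvlArgT => 10 * 2 ^ x.2) := (natMul.comp ((const _ 10).pair L_code)).congr fun _ => rfl
  exact (natMul.comp ((natMul.comp ((natMul.comp ((natMul.comp (h10L.pair h2β)).pair hpT)).pair (natMul.comp ((const _ 𝔭).pair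
    (natMul.comp (T_code.pair (const _ 2))))))).pair (const _ (16 * 𝔭)))).congr fun _ => rfl
/-- The exponent of `Reps`. [folklore] -/
theorem repsExp_code : CodeFP lvlArgE unE (fun x : LvlArgT => repsExpP x.1.1 x.1.2.1 x.1.2.2 x.2) :=
  (unAdd.comp ((unAdd.comp ((unAdd.comp ((unAdd.comp ((unAdd.comp ((unMul.comp ((const _ 4).pair ℓ_code)).pair
    (unMul.comp ((const _ 3).pair τ_code)))).pair (const _ (8 * PP)))).pair (unMul.comp ((unMul.comp ((const _ 2).pair kk_code)).pair
    (const _ PP))))).pair s_code)).pair (const _ 80))).congr fun _ => rfl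
/-- `Reps` (binary). [folklore] -/
theorem Reps_code : CodeFP lvlArgE natE (fun x : LvlArgT => RepsP x.1.1 x.1.2.1 x.1.2.2 x.2) := (natPow.comp ((const _ 2).pair repsExp_code)).congr fun _ => rfl
/-- `M` (binary). [folklore] -/
theorem M_code : CodeFP lvlArgE natE (fun x : LvlArgT => MP x.1.1 x.1.2.1 x.1.2.2 x.2) :=
  (natMul.comp ((natMul.comp ((const _ 64).pair (natPow.comp ((const _ 4).pair s_code)))).pair (natOfUn.comp (unAdd.comp ((unAdd.comp (repsExp_code.pair
    (unMul.comp ((const _ 2).pair s_code)))).pair (const _ 8)))))).congr fun _ => rfl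
/-- `runLen` (binary). [folklore] -/
theorem runLen_code : CodeFP lvlArgE natE (fun x : LvlArgT => lvlRunLenP x.1.1 x.1.2.1 x.1.2.2 x.2) :=
  (runLenP_natCode.comp ((natOfUn.comp n_code).pair (k_code.pair ((natOfUn.comp β_code).pair (T_code.pair ((natOfUn.comp ℓ_code).pair (Q_code.pair
    (L_code.pair ((natOfUn.comp kk_code).pair (t_code.pair ((natOfUn.comp κ_code).pair (natOfUn.comp τ_code)))))))))))).congr fun _ => rfl
/-- `nQRun` (binary). [folklore] -/
theorem nQRun_code : CodeFP lvlArgE natE (fun x : LvlArgT => nQRunP x.1.1 x.1.2.1 x.1.2.2 x.2) :=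
  (natAdd.comp ((natAdd.comp ((natMul.comp ((natMul.comp (L_code.pair L_code)).pair (natMul.comp ((natMul.comp (T_code.pair (const _ 2))).pair k_code)))).pair
    (natMul.comp ((natMul.comp (T_code.pair (const _ 2))).pair k_code)))).pair k_code)).congr fun _ => rfl
/-- `slot` (binary). [folklore] -/
theorem slot_code : CodeFP lvlArgE natE (fun x : LvlArgT => lvlSlotP x.1.1 x.1.2.1 x.1.2.2 x.2) := (natAdd.comp (runLen_code.pair nQRun_code)).congr fun _ => rfl
/-- `blockLen` (binary). [folklore] -/
theorem blockLen_code : CodeFP lvlArgE natE (fun x : LvlArgT => lvlBlockLenP x.1.1 x.1.2.1 x.1.2.2 x.2) :=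
  (natAdd.comp ((natMul.comp (Reps_code.pair slot_code)).pair (natMul.comp (M_code.pair (natOfUn.comp n_code))))).congr fun _ => rfl

end LvlArg

end Codes

end Modp

end Literature.Computability.Learning
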